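import Mathlib
import Summits.Ventures.PercRepro2.Defs
import Summits.Ventures.PercRepro2.Independence
import Summits.Ventures.PercRepro2.Harris
import Summits.Ventures.PercRepro2.Graph
import Summits.Ventures.PercRepro2.RestrictClosure

/-!
# The first-hit decomposition is exact across a separating pair (blind cell PercRepro2, mine-2)

**Theorem M2-5** (`conjectures/MINE-2.md`, paper proof `mining/mine-2/PROOF-M2-5.md`).
Let `A = {a₁, a₂}` separate the root `o` from `b` — `b` is not reached from `o` once every edge
touching `A` is closed (`Separates`) — and let `h_i = P(C(o) ∩ A = {a_i})` be the first-hit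
weights.  Then the Kozma–Nitzan Theorem-1 inequality
`P(o ↔ b) ≥ Σ_i h_i / (h₁ + h₂) · P(o ↔ A, a_i ↔ b)` holds with **equality**:

`(h₁ + h₂) · P(o ↔ b) = h₁ · P(o ↔ A, a₁ ↔ b) + h₂ · P(o ↔ A, a₂ ↔ b)`

(`sepPair_firstHit_decomposition`).  Proof: with `D = {a₁ ↮ a₂}` and `K` the component of `o`
in `G − A`, split the edges into `F₁ = touches K` and `F₂ = F₁ᶜ`; then `D = D₁ ∩ D₂` with `D_i`
determined by `F_i`, and on `D` every connection `o ↔ a_i` lives inside `F₁` and every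
connection `b ↔ a_j` inside `F₂` (`conn_restrictTo_of_not_conn`).  Independence of disjoint edge
sets gives the **conditional independence across the pair**
`P(o ↔ a_i, b ↔ a_j, D) · P(D) = P(o ↔ a_i, D) · P(b ↔ a_j, D)` (`prob_conn_inter_mul`), whence the
two cross-balance identities `h₂ · P(S = {a₁}, o ↔ b) = h₁ · P(S = {a₂}, a₁ ↔ b)` and the theorem.
-/

namespace Summit.Ventures.PercRepro2

namespace SepPair

/-! ## Conditional independence across the pair, and the theorem -/

section Main

variable {V : Type*} {E : Type*} [Fintype E] [DecidableEq E] {R : Type*} [CommRing R]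

set_option maxHeartbeats 400000 in
/-- **Conditional independence across a separating pair.**  If `b` is not reached from `o` in
`G − {a₁, a₂}`, then for `i, j ∈ {a₁, a₂}` and `D = {a₁ ↮ a₂}`:
`P(o ↔ i, j ↔ b, D) · P(D) = P(o ↔ i, D) · P(j ↔ b, D)`. -/
theorem prob_conn_inter_mul (p : E → R) (ends : E → Sym2 V) {o a₁ a₂ b : V}
    (ho : o ∉ ({a₁, a₂} : Set V)) (hsep : ¬ Conn ends (sepConfig ends {a₁, a₂}) o b)
    {i j : V} (hi : i = a₁ ∨ i = a₂) (hj : j = a₁ ∨ j = a₂) :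
    prob p (connEvent ends o i ∩ connEvent ends j b ∩ (connEvent ends a₁ a₂)ᶜ) *
        prob p (connEvent ends a₁ a₂)ᶜ =
      prob p (connEvent ends o i ∩ (connEvent ends a₁ a₂)ᶜ) *
        prob p (connEvent ends j b ∩ (connEvent ends a₁ a₂)ᶜ) := by
  classical
  have hbK : b ∉ cluster ends (sepConfig ends ({a₁, a₂} : Set V)) o := hsep
  -- pointwise descriptions on `D`
  have hDω : ∀ ω : Config E, ω ∈ (connEvent ends a₁ a₂)ᶜ ↔
      restrictTo (touches ends (cluster ends (sepConfig ends {a₁, a₂}) o)) ω ∈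
          (connEvent ends a₁ a₂)ᶜ ∧
        restrictTo (touches ends (cluster ends (sepConfig ends {a₁, a₂}) o))ᶜ ω ∈
          (connEvent ends a₁ a₂)ᶜ :=
    fun ω => not_conn_pair_iff ho ω
  have hXω : ∀ ω : Config E, ω ∈ (connEvent ends a₁ a₂)ᶜ → (ω ∈ connEvent ends o i ↔
      restrictTo (touches ends (cluster ends (sepConfig ends {a₁, a₂}) o)) ω ∈
        connEvent ends o i) :=
    fun ω hω => ⟨fun hx => conn_restrictTo_of_not_conn (exit_touches ho ω) hω hi hx,
      fun hx => conn_of_conn_restrictTo hx⟩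
  have hYω : ∀ ω : Config E, ω ∈ (connEvent ends a₁ a₂)ᶜ → (ω ∈ connEvent ends j b ↔
      restrictTo (touches ends (cluster ends (sepConfig ends {a₁, a₂}) o))ᶜ ω ∈
        connEvent ends j b) :=
    fun ω hω => ⟨fun hy => conn_symm
        (conn_restrictTo_of_not_conn (exit_compl ho hbK ω) hω hj (conn_symm hy)),
      fun hy => conn_of_conn_restrictTo hy⟩
  -- independence of the two edge sets
  have ind : ∀ A B : Set (Config E),
      prob p (restrictTo (touches ends (cluster ends (sepConfig ends {a₁, a₂}) o)) ⁻¹' A ∩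
          restrictTo (touches ends (cluster ends (sepConfig ends {a₁, a₂}) o))ᶜ ⁻¹' B) =
        prob p (restrictTo (touches ends (cluster ends (sepConfig ends {a₁, a₂}) o)) ⁻¹' A) *
          prob p (restrictTo (touches ends (cluster ends (sepConfig ends {a₁, a₂}) o))ᶜ ⁻¹' B) :=
    fun A B => prob_inter_eq_mul_of_dependsOn p disjoint_compl_right
      (dependsOn_restrictTo _ A) (dependsOn_restrictTo _ B)
  -- the four events as products
  have e1 : connEvent ends o i ∩ connEvent ends j b ∩ (connEvent ends a₁ a₂)ᶜ =
      restrictTo (touches ends (cluster ends (sepConfig ends {a₁, a₂}) o)) ⁻¹'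
          (connEvent ends o i ∩ (connEvent ends a₁ a₂)ᶜ) ∩
        restrictTo (touches ends (cluster ends (sepConfig ends {a₁, a₂}) o))ᶜ ⁻¹'
          (connEvent ends j b ∩ (connEvent ends a₁ a₂)ᶜ) := by
    ext ω
    have := hDω ω; have := hXω ω; have := hYω ω
    simp only [Set.mem_inter_iff, Set.mem_preimage]
    tauto
  have e2 : (connEvent ends a₁ a₂)ᶜ =
      restrictTo (touches ends (cluster ends (sepConfig ends {a₁, a₂}) o)) ⁻¹'
          (connEvent ends a₁ a₂)ᶜ ∩
        restrictTo (touches ends (cluster ends (sepConfig ends {a₁, a₂}) o))ᶜ ⁻¹'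
          (connEvent ends a₁ a₂)ᶜ := by
    ext ω
    have := hDω ω
    simp only [Set.mem_inter_iff, Set.mem_preimage]
    tauto
  have e3 : connEvent ends o i ∩ (connEvent ends a₁ a₂)ᶜ =
      restrictTo (touches ends (cluster ends (sepConfig ends {a₁, a₂}) o)) ⁻¹'
          (connEvent ends o i ∩ (connEvent ends a₁ a₂)ᶜ) ∩
        restrictTo (touches ends (cluster ends (sepConfig ends {a₁, a₂}) o))ᶜ ⁻¹'
          (connEvent ends a₁ a₂)ᶜ := by
    ext ω
    have := hDω ω; have := hXω ω
    simp only [Set.mem_inter_iff, Set.mem_preimage]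
    tauto
  have e4 : connEvent ends j b ∩ (connEvent ends a₁ a₂)ᶜ =
      restrictTo (touches ends (cluster ends (sepConfig ends {a₁, a₂}) o)) ⁻¹'
          (connEvent ends a₁ a₂)ᶜ ∩
        restrictTo (touches ends (cluster ends (sepConfig ends {a₁, a₂}) o))ᶜ ⁻¹'
          (connEvent ends j b ∩ (connEvent ends a₁ a₂)ᶜ) := by
    ext ω
    have := hDω ω; have := hYω ω
    simp only [Set.mem_inter_iff, Set.mem_preimage]
    tauto
  have p1 := congrArg (prob p) e1
  have p2 := congrArg (prob p) e2
  have p3 := congrArg (prob p) e3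
  have p4 := congrArg (prob p) e4
  rw [ind] at p1 p2 p3 p4
  rw [p1, p2, p3, p4]
  ring


omit [Fintype E] [DecidableEq E] in
/-- `{o ↔ a₁, o ↮ a₂} = {o ↔ a₁, a₁ ↮ a₂}`: the first-hit event `S = {a₁}` in `D`-form. -/
lemma inter_compl_eq_inter_compl_pair (ends : E → Sym2 V) (o a₁ a₂ : V) :
    connEvent ends o a₁ ∩ (connEvent ends o a₂)ᶜ =
      connEvent ends o a₁ ∩ (connEvent ends a₁ a₂)ᶜ := by
  ext ω
  simp only [Set.mem_inter_iff, Set.mem_compl_iff, mem_connEvent]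
  exact and_congr_right fun h1 =>
    ⟨fun h2 h12 => h2 (conn_trans h1 h12), fun h12 h2 => h12 (conn_trans (conn_symm h1) h2)⟩

omit [Fintype E] [DecidableEq E] in
/-- `{o ↔ a₂, o ↮ a₁} = {o ↔ a₂, a₁ ↮ a₂}`. -/
lemma inter_compl_eq_inter_compl_pair' (ends : E → Sym2 V) (o a₁ a₂ : V) :
    connEvent ends o a₂ ∩ (connEvent ends o a₁)ᶜ =
      connEvent ends o a₂ ∩ (connEvent ends a₁ a₂)ᶜ := by
  ext ω
  simp only [Set.mem_inter_iff, Set.mem_compl_iff, mem_connEvent]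
  exact and_congr_right fun h2 =>
    ⟨fun h1 h12 => h1 (conn_trans h2 (conn_symm h12)),
      fun h12 h1 => h12 (conn_trans (conn_symm h1) h2)⟩

variable [LinearOrder R] [IsStrictOrderedRing R]

/-- **Theorem M2-5 — the first-hit decomposition is exact across a separating pair.**
If `b` is not reached from `o` once every edge touching `A = {a₁, a₂}` is closed, then with the
first-hit weights `h_i = P(o ↔ a_i, o ↮ a_{3−i}) = P(C(o) ∩ A = {a_i})`:
`(h₁ + h₂) · P(o ↔ b) = h₁ · P(o ↔ A, a₁ ↔ b) + h₂ · P(o ↔ A, a₂ ↔ b)`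
— the Kozma–Nitzan Theorem-1 inequality (KN24 (38), `b ∉ A`) holds with equality. -/
theorem sepPair_firstHit_decomposition {p : E → R} (hp : IsProbVec p) (ends : E → Sym2 V)
    {o a₁ a₂ b : V} (ho : o ∉ ({a₁, a₂} : Set V)) (hb : b ∉ ({a₁, a₂} : Set V))
    (hsep : ¬ Conn ends (sepConfig ends {a₁, a₂}) o b) :
    (prob p (connEvent ends o a₁ ∩ (connEvent ends o a₂)ᶜ) +
        prob p (connEvent ends o a₂ ∩ (connEvent ends o a₁)ᶜ)) * prob p (connEvent ends o b) =
      prob p (connEvent ends o a₁ ∩ (connEvent ends o a₂)ᶜ) *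
          prob p ((connEvent ends o a₁ ∪ connEvent ends o a₂) ∩ connEvent ends a₁ b) +
        prob p (connEvent ends o a₂ ∩ (connEvent ends o a₁)ᶜ) *
          prob p ((connEvent ends o a₁ ∪ connEvent ends o a₂) ∩ connEvent ends a₂ b) := by
  classical
  rw [inter_compl_eq_inter_compl_pair, inter_compl_eq_inter_compl_pair']
  -- the conditional-independence identities
  have c11 := prob_conn_inter_mul p ends ho hsep (Or.inl rfl : a₁ = a₁ ∨ a₁ = a₂)
    (Or.inl rfl : a₁ = a₁ ∨ a₁ = a₂)
  have c21 := prob_conn_inter_mul p ends ho hsep (Or.inr rfl : a₂ = a₁ ∨ a₂ = a₂)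
    (Or.inl rfl : a₁ = a₁ ∨ a₁ = a₂)
  have c12 := prob_conn_inter_mul p ends ho hsep (Or.inl rfl : a₁ = a₁ ∨ a₁ = a₂)
    (Or.inr rfl : a₂ = a₁ ∨ a₂ = a₂)
  have c22 := prob_conn_inter_mul p ends ho hsep (Or.inr rfl : a₂ = a₁ ∨ a₂ = a₂)
    (Or.inr rfl : a₂ = a₁ ∨ a₂ = a₂)
  -- the pointwise identity, integrated
  have key : (prob p (connEvent ends o a₁ ∩ (connEvent ends a₁ a₂)ᶜ) +
        prob p (connEvent ends o a₂ ∩ (connEvent ends a₁ a₂)ᶜ)) * prob p (connEvent ends o b) -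
      prob p (connEvent ends o a₁ ∩ (connEvent ends a₁ a₂)ᶜ) *
        prob p ((connEvent ends o a₁ ∪ connEvent ends o a₂) ∩ connEvent ends a₁ b) -
      prob p (connEvent ends o a₂ ∩ (connEvent ends a₁ a₂)ᶜ) *
        prob p ((connEvent ends o a₁ ∪ connEvent ends o a₂) ∩ connEvent ends a₂ b) =
      prob p (connEvent ends o a₂ ∩ (connEvent ends a₁ a₂)ᶜ) *
          prob p (connEvent ends o a₁ ∩ connEvent ends a₁ b ∩ (connEvent ends a₁ a₂)ᶜ) -
        prob p (connEvent ends o a₁ ∩ (connEvent ends a₁ a₂)ᶜ) *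
          prob p (connEvent ends o a₂ ∩ connEvent ends a₁ b ∩ (connEvent ends a₁ a₂)ᶜ) +
        prob p (connEvent ends o a₁ ∩ (connEvent ends a₁ a₂)ᶜ) *
          prob p (connEvent ends o a₂ ∩ connEvent ends a₂ b ∩ (connEvent ends a₁ a₂)ᶜ) -
        prob p (connEvent ends o a₂ ∩ (connEvent ends a₁ a₂)ᶜ) *
          prob p (connEvent ends o a₁ ∩ connEvent ends a₂ b ∩ (connEvent ends a₁ a₂)ᶜ) := by
    generalize prob p (connEvent ends o a₁ ∩ (connEvent ends a₁ a₂)ᶜ) = h₁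
    generalize prob p (connEvent ends o a₂ ∩ (connEvent ends a₁ a₂)ᶜ) = h₂
    simp only [prob, Finset.mul_sum, ← Finset.sum_sub_distrib, ← Finset.sum_add_distrib]
    refine Finset.sum_congr rfl fun ω _ => ?_
    simp only [Set.indicator_apply, Set.mem_inter_iff, Set.mem_union, Set.mem_compl_iff,
      mem_connEvent]
    have c₁ : ¬ Conn ends ω a₁ a₂ → Conn ends ω o a₁ → Conn ends ω o a₂ → False :=
      fun hd h1 h2 => hd (conn_trans (conn_symm h1) h2)
    have c₂ : Conn ends ω a₁ a₂ → Conn ends ω o a₁ → Conn ends ω o a₂ :=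
      fun h12 h1 => conn_trans h1 h12
    have c₃ : Conn ends ω a₁ a₂ → Conn ends ω o a₂ → Conn ends ω o a₁ :=
      fun h12 h2 => conn_trans h2 (conn_symm h12)
    have c₄ : Conn ends ω o a₁ → Conn ends ω a₁ b → Conn ends ω o b := conn_trans
    have c₅ : Conn ends ω o a₂ → Conn ends ω a₂ b → Conn ends ω o b := conn_trans
    have c₆ : Conn ends ω o a₁ → Conn ends ω o b → Conn ends ω a₁ b :=
      fun h1 hz => conn_trans (conn_symm h1) hz
    have c₇ : Conn ends ω o a₂ → Conn ends ω o b → Conn ends ω a₂ b :=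
      fun h2 hz => conn_trans (conn_symm h2) hz
    have c₈ : Conn ends ω o b → Conn ends ω o a₁ ∨ Conn ends ω o a₂ :=
      conn_pair_of_conn ho hb hsep
    by_cases hd : Conn ends ω a₁ a₂ <;> by_cases hx₁ : Conn ends ω o a₁ <;>
      by_cases hx₂ : Conn ends ω o a₂ <;> by_cases hy₁ : Conn ends ω a₁ b <;>
      by_cases hy₂ : Conn ends ω a₂ b <;> by_cases hz : Conn ends ω o b <;>
      simp only [hd, hx₁, hx₂, hy₁, hy₂, hz, not_true_eq_false, not_false_eq_true, and_self,
        and_true, and_false, or_self, or_true, or_false, if_true, if_false, mul_zero, sub_zero,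
        zero_sub, add_zero, zero_add] <;>
      first
        | ring1
        | exact (c₁ hd hx₁ hx₂).elim
        | exact absurd (c₂ hd hx₁) hx₂
        | exact absurd (c₃ hd hx₂) hx₁
        | exact absurd (c₄ hx₁ hy₁) hz
        | exact absurd (c₅ hx₂ hy₂) hz
        | exact absurd (c₆ hx₁ hz) hy₁
        | exact absurd (c₇ hx₂ hz) hy₂
        | exact ((c₈ hz).elim hx₁ hx₂).elim
  by_cases hD0 : prob p (connEvent ends a₁ a₂)ᶜ = 0
  · -- `P(D) = 0`: both first-hit weights vanish
    have h1 : prob p (connEvent ends o a₁ ∩ (connEvent ends a₁ a₂)ᶜ) = 0 := by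
      have := prob_mono hp (Set.inter_subset_right :
        connEvent ends o a₁ ∩ (connEvent ends a₁ a₂)ᶜ ⊆ (connEvent ends a₁ a₂)ᶜ)
      rw [hD0] at this
      exact le_antisymm this (prob_nonneg hp _)
    have h2 : prob p (connEvent ends o a₂ ∩ (connEvent ends a₁ a₂)ᶜ) = 0 := by
      have := prob_mono hp (Set.inter_subset_right :
        connEvent ends o a₂ ∩ (connEvent ends a₁ a₂)ᶜ ⊆ (connEvent ends a₁ a₂)ᶜ)
      rw [hD0] at this
      exact le_antisymm this (prob_nonneg hp _)
    rw [h1, h2]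
    ring
  · -- `P(D) ≠ 0`: the two cross-balance identities
    have cb1 : prob p (connEvent ends o a₂ ∩ (connEvent ends a₁ a₂)ᶜ) *
          prob p (connEvent ends o a₁ ∩ connEvent ends a₁ b ∩ (connEvent ends a₁ a₂)ᶜ) -
        prob p (connEvent ends o a₁ ∩ (connEvent ends a₁ a₂)ᶜ) *
          prob p (connEvent ends o a₂ ∩ connEvent ends a₁ b ∩ (connEvent ends a₁ a₂)ᶜ) = 0 := by
      have hmul : (prob p (connEvent ends o a₂ ∩ (connEvent ends a₁ a₂)ᶜ) *
          prob p (connEvent ends o a₁ ∩ connEvent ends a₁ b ∩ (connEvent ends a₁ a₂)ᶜ) -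
        prob p (connEvent ends o a₁ ∩ (connEvent ends a₁ a₂)ᶜ) *
          prob p (connEvent ends o a₂ ∩ connEvent ends a₁ b ∩ (connEvent ends a₁ a₂)ᶜ)) *
          prob p (connEvent ends a₁ a₂)ᶜ = 0 := by
        linear_combination prob p (connEvent ends o a₂ ∩ (connEvent ends a₁ a₂)ᶜ) * c11 -
          prob p (connEvent ends o a₁ ∩ (connEvent ends a₁ a₂)ᶜ) * c21
      exact (mul_eq_zero.1 hmul).resolve_right hD0
    have cb2 : prob p (connEvent ends o a₁ ∩ (connEvent ends a₁ a₂)ᶜ) *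
          prob p (connEvent ends o a₂ ∩ connEvent ends a₂ b ∩ (connEvent ends a₁ a₂)ᶜ) -
        prob p (connEvent ends o a₂ ∩ (connEvent ends a₁ a₂)ᶜ) *
          prob p (connEvent ends o a₁ ∩ connEvent ends a₂ b ∩ (connEvent ends a₁ a₂)ᶜ) = 0 := by
      have hmul : (prob p (connEvent ends o a₁ ∩ (connEvent ends a₁ a₂)ᶜ) *
          prob p (connEvent ends o a₂ ∩ connEvent ends a₂ b ∩ (connEvent ends a₁ a₂)ᶜ) -
        prob p (connEvent ends o a₂ ∩ (connEvent ends a₁ a₂)ᶜ) *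
          prob p (connEvent ends o a₁ ∩ connEvent ends a₂ b ∩ (connEvent ends a₁ a₂)ᶜ)) *
          prob p (connEvent ends a₁ a₂)ᶜ = 0 := by
        linear_combination prob p (connEvent ends o a₁ ∩ (connEvent ends a₁ a₂)ᶜ) * c22 -
          prob p (connEvent ends o a₂ ∩ (connEvent ends a₁ a₂)ᶜ) * c12
      exact (mul_eq_zero.1 hmul).resolve_right hD0
    linear_combination key + cb1 + cb2

end Main

end SepPair

end Summit.Ventures.PercRepro2
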